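import Mathlib
import HarnessLib

/-!
# Regular-point capture: a domain of finite Krull dimension has no proper quotient of the same dimension
# (crux `ProModularOfGKBound`, helper)

Route `EisensteinGelfandKirillov`, crux stmt-Langlands-18273 (`ProModularOfGKBound`).  Kernel-checked form of
the commutative-algebra step `CaptureAtRegularPoint` that the crux idea card `hecke-fibre-capture` (crux-ideate
r1, ideator 1, step (4)) isolates: at a Newton–Thorne-smooth classical point `x` the completed local ring
`A = (R^{ps}[1/p])^∧_x` is a regular local DOMAIN of dimension `2[F:ℚ]`, the pro-modular closed subscheme
through `x` is `Spec (A ⧸ J)` with `dim (A ⧸ J) ≥ 2[F:ℚ] = dim A` (Hecke lower bound from the door), hence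
`J = 0` and the whole component is pro-modular.  The algebra used is only:

* `ringKrullDim_quotient_add_one_le_of_ne_bot` — for a domain `A` and an ideal `J ≠ 0`,
  `dim (A ⧸ J) + 1 ≤ dim A` (a chain of primes of `A ⧸ J` lifts to primes containing `J ∋ r ≠ 0`, and
  `(0)` is a further prime below; Mathlib's `ringKrullDim_succ_le_of_surjective`);
* `eq_bot_of_ringKrullDim_quotient_eq` / `eq_bot_of_le_ringKrullDim_quotient` — CAPTURE: if `dim A = d < ∞`
  and `dim (A ⧸ J) ≥ d` then `J = ⊥`.

Pure commutative algebra; it supports the crux item, it does not close it.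

References: standard (e.g. Matsumura, *Commutative Ring Theory*, §5; Bruns–Herzog, *Cohen–Macaulay rings*,
Prop. 1.2.12 and A.4). [folklore]
-/

set_option linter.dupNamespace false -- `Summit.Langlands.Langlands.Theorems` is the mandated Theorems namespace (summit = problem name)

namespace Summit.Langlands.Langlands.Theorems

open scoped nonZeroDivisors

variable {A : Type*} [CommRing A] [IsDomain A]

/-- In a domain, killing a nonzero ideal drops the Krull dimension: `dim (A ⧸ J) + 1 ≤ dim A` for `J ≠ ⊥`.
[folklore] -/
theorem ringKrullDim_quotient_add_one_le_of_ne_bot {J : Ideal A} (hJ : J ≠ ⊥) :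
    ringKrullDim (A ⧸ J) + 1 ≤ ringKrullDim A := by
  obtain ⟨r, hrJ, hr0⟩ := Submodule.exists_mem_ne_zero_of_ne_bot hJ
  exact ringKrullDim_succ_le_of_surjective (Ideal.Quotient.mk J) Ideal.Quotient.mk_surjective
    (mem_nonZeroDivisors_of_ne_zero hr0) (Ideal.Quotient.eq_zero_iff_mem.2 hrJ)

/-- **Capture at a point of full dimension.**  If a domain `A` has finite Krull dimension `d` and a
quotient `A ⧸ J` still has dimension `≥ d`, then `J = ⊥` (the closed subscheme is everything). [folklore] -/
theorem eq_bot_of_le_ringKrullDim_quotient {d : ℕ} (hA : ringKrullDim A = d) {J : Ideal A}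
    (hJ : (d : WithBot ℕ∞) ≤ ringKrullDim (A ⧸ J)) : J = ⊥ := by
  by_contra hne
  have h : (d : WithBot ℕ∞) + 1 ≤ ringKrullDim A :=
    (add_le_add hJ le_rfl).trans (ringKrullDim_quotient_add_one_le_of_ne_bot hne)
  rw [hA, ← WithBot.coe_natCast, ← WithBot.coe_one, ← WithBot.coe_add, WithBot.coe_le_coe,
    ← ENat.coe_one, ← ENat.coe_add, ENat.coe_le_coe] at h
  omega

/-- **Capture, equality form**: in a domain of finite Krull dimension `d`, a quotient of dimension exactly
`d` is the trivial quotient. [folklore] -/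
theorem eq_bot_of_ringKrullDim_quotient_eq {d : ℕ} (hA : ringKrullDim A = d) {J : Ideal A}
    (hJ : ringKrullDim (A ⧸ J) = d) : J = ⊥ :=
  eq_bot_of_le_ringKrullDim_quotient hA hJ.ge

/-- The same with the finiteness hypothesis in the form `ringKrullDim A < ⊤`: no nonzero ideal `J` has
`dim (A ⧸ J) = dim A`. [folklore] -/
theorem eq_bot_of_ringKrullDim_quotient_eq_of_lt_top (hA : ringKrullDim A < ⊤) {J : Ideal A}
    (hJ : ringKrullDim (A ⧸ J) = ringKrullDim A) : J = ⊥ := by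
  -- `dim A` is a natural number: not `⊥` (a domain is nontrivial) and not `⊤`
  obtain ⟨d, hd⟩ : ∃ d : ℕ, ringKrullDim A = d := by
    have hne : ringKrullDim A ≠ ⊥ := ne_bot_of_le_ne_bot WithBot.coe_ne_bot ringKrullDim_nonneg_of_nontrivial
    induction hdim : ringKrullDim A using WithBot.recBotCoe with
    | bot => exact absurd hdim hne
    | coe e =>
      induction e using ENat.recTopCoe with
      | top => exact absurd hdim (ne_of_lt hA)
      | coe d => exact ⟨d, rfl⟩
  exact eq_bot_of_ringKrullDim_quotient_eq hd (hJ.trans hd)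

end Summit.Langlands.Langlands.Theorems
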